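import Summits.BirchSwinnertonDyer.BirchSwinnertonDyer.Theses.TwoAdicConverse
import Summits.BirchSwinnertonDyer.BirchSwinnertonDyer.Theorems.TwoAdicConverseTwistSupply
import HarnessLib

/-!
# Route `TwoAdicConverse`, multiplicative node — the support item `MultTwistSupplyAtTwo`
(stmt-BirchSwinnertonDyer-19186) from the ONE named PRINT fact Hoffstein–Luo 1997

The support child `MultTwistSupplyAtTwo` of the split of `MultiplicativeRankZeroTwoConverse`
(stmt-BirchSwinnertonDyer-19219) asks, for every non-CM `E/ℚ` multiplicative at `2`, for a quadratic
field `K` with `2` SPLIT in `K` (`X5.AddTwoL2Cyc.TwoSplit K`, `d_K ≡ 1 (mod 8)`) and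
`L(E^(d_K),1) ≠ 0` (`X5.AddTwoL2.ExistsNonvanishingTwistWith`). Seat bsd-2adic-mult GEN 4 proved this
for EVERY elliptic curve over `ℚ` (no CM / reduction / root-number hypothesis) modulo the tree's named
fact `Literature.NumberTheory.EllipticCurves.HoffsteinLuo1997_exists_twist_L_one_ne_zero` (a squarefree
`d ≡ 1 (mod 8)` of either sign with `L(E^(d),1) ≠ 0`; Hoffstein–Luo 1997, Theorem of §1) as
`existsNonvanishingTwistWith_twoSplit_of_hoffsteinLuo` (p410645, `Theorems/TwoAdicConverseTwistSupply.lean`).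
This file states that discharge against the REGISTERED item constant. HONEST FRAMING (cell bsd-2adic,
seat bsd-2adic-conv-2, D-0074 (A)): CONDITIONAL on the displayed Literature fact (a
`conditional-result`; the item is a PUB support, never counted as progress); nothing else asserted.
[cite: HoffsteinLuo1997, Theorem (§1, pp. 435–436)]
-/

set_option autoImplicit false
set_option linter.dupNamespace false

open Literature.NumberTheory.EllipticCurves

namespace Summit.BirchSwinnertonDyer.BirchSwinnertonDyer.Theorems

/-- **Support item stmt-BirchSwinnertonDyer-19186 modulo Hoffstein–Luo 1997.** The named PRINT fact
`HoffsteinLuo1997_exists_twist_L_one_ne_zero` implies `MultTwistSupplyAtTwo`: for every non-CM `E/ℚ`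
multiplicative at `2` (indeed for every `E/ℚ`) there is a quadratic `K` with `2` split in `K` and
`L(E^(d_K),1) ≠ 0` — one application of `existsNonvanishingTwistWith_twoSplit_of_hoffsteinLuo`
(p410645), the hypotheses `¬ W.HasCM` and `Mult W 2` being unused.
[cite: HoffsteinLuo1997, Theorem (§1, pp. 435–436)] -/
theorem multTwistSupplyAtTwo_of_hoffsteinLuo (hHL : HoffsteinLuo1997_exists_twist_L_one_ne_zero) :
    Summit.BirchSwinnertonDyer.BirchSwinnertonDyer.Theses.TwoAdicConverse.MultTwistSupplyAtTwo := by
  unfold Summit.BirchSwinnertonDyer.BirchSwinnertonDyer.Theses.TwoAdicConverse.MultTwistSupplyAtTwo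
  intro W _ _ _ _
  exact existsNonvanishingTwistWith_twoSplit_of_hoffsteinLuo hHL W

end Summit.BirchSwinnertonDyer.BirchSwinnertonDyer.Theorems
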